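import Summits.BirchSwinnertonDyer.BirchSwinnertonDyer.Theorems.EisensteinPrimesBSDpOnCellCTelescopeBranchLatticeOfUntwisted
import Literature.NumberTheory.EllipticCurves.PNewBranchUntwistedGaloisLattice
import Literature.NumberTheory.EllipticCurves.CaiShuTian2014.HeegnerConditionProofs
import HarnessLib

/-!
# [telescope — width x2-p2 g24, 2026-08-30] THE v18 BRIDGE: T-An-2ᴴ ⊢ T-An-2ᵍ — Hida's UNTWISTED branch lattice with fibres «equivalent as
# Galois representations into GL₂(Ω)», `Ω = ℂ_p` (ideator bsd-idea-12 g42's print-verbatim sibling fact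
# `hida1986_castella2020_exists_untwistedGaloisLattice_on_pNewBranchChart`, module `PNewBranchUntwistedGaloisLattice`) IMPLIES the assembled
# fact `hida1986_castella2020_exists_galoisLattice_on_pNewBranchChart` that telescope v17's `stub_assembledFactsG` names
# Crux 4 `BSDpOnCellC` (stmt-BirchSwinnertonDyer-19034), line «telescope» (`--supports`, helper; closes nothing; enables LEAD g5's three-line v18)

WHY: LEAD g5's standing rule (eis INBOX 11:26:09Z, host-endorsed 11:27:27Z): a re-typing of the load-bearing fact that is CLOSER TO PRINT is adopted as
telescope v18 = `stub_assembledFactsG : T-An-2ᵍ` ↦ `stub_assembledFactsH : T-An-2ᴴ` with the analytic slot fed through a LANDED bridge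
`T-An-2ᴴ → T-An-2ᵍ`. THIS FILE is that bridge: the binders and the analytic conjuncts ((an∞), (an_t), the chart) pass through unchanged, and the
Galois clause `∃ π, IsUntwistedBranchGaloisLattice W p x D π` ((U-unr) = (2.2b); (U-fib₀)/(U-fib_t) = (2.2c) read over `Ω = ℂ_p` with UNTWISTED
member fibres given as the specialisations `(π σ).map (evalHom x_t)`; (U-rat)) is turned into `∃ ρ, IsBranchGaloisLattice W p x D ρ` by this
seat's `TelescopeBranchLatticeOfUntwisted.exists_isBranchGaloisLattice_of_chart_of_untwisted_conjOver` at `Ω := ℂ_[p]` — i.e. by the critical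
twist character `Θ` (p770687; `ρ = π ⊗ Θ`), the descent of conjugacy `ℂ_p → ℚ_p / K_t` (p769852) and the Weierstrass remainder (p770433). The two
extra inputs of that theorem come from T-An-2ᴴ's own binders: `p ≠ 2` from `2 < p`, and `p ∣ N` from `W.HasMultiplicativeReductionAtPrime p`
(`dvd_conductorNorm_of_hasMultiplicativeReductionAtPrime`, via the tree's `factorization_conductorNorm_eq_one_of_hasMultiplicativeReductionAtPrime`).

CONTENT (namespace `…Theorems.TelescopeBranchGaloisLatticeOfUntwistedFact`; THEOREMS ONLY): `dvd_conductorNorm_of_hasMultiplicativeReductionAtPrime`,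
**`galoisLattice_of_untwistedGaloisLattice : hida1986_castella2020_exists_untwistedGaloisLattice_on_pNewBranchChart →
hida1986_castella2020_exists_galoisLattice_on_pNewBranchChart`** (conclusion = the EXACT decl v17 names, so the v18 slot is ONE application).

HONEST FRAMING: an implication between two NAMED FACTS (both `def … : Prop`, D-0014); neither is proved here; no Galois lattice is constructed from a
modular form; closes no registered stub, no crux, no summit statement; BSD is proved for no curve by this file. No named fact is declared, no
definition, no instance, no `sorry`.
References (shape only): [cite: Hida1986, Thm. 2.1 (2.2b) (2.2c) (p. 557)] [cite: Howard2007BigHeegner, Def. 2.1.3] [cite: Silverman1994, IV.10.2(b)]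
-/

set_option autoImplicit false
set_option linter.dupNamespace false

noncomputable section

open scoped Classical MatrixGroups ModularForm PowerSeries.WithPiTopology
open PowerSeries IsDedekindDomain NumberField CongruenceSubgroup Field Filter
open Literature.NumberTheory.EllipticCurves Literature.NumberTheory.EllipticCurves.GreenbergSelmer
  Literature.NumberTheory.EllipticCurves.ModularForms Literature.NumberTheory.GaloisRepresentations
  Summit.BirchSwinnertonDyer.BirchSwinnertonDyer.Theorems.TelescopeBranchLatticeOfUntwisted

namespace Summit.BirchSwinnertonDyer.BirchSwinnertonDyer.Theorems.TelescopeBranchGaloisLatticeOfUntwistedFact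

/-- `p ∣ N_E` for a prime `p` of multiplicative reduction (`f_p = 1`, the tree's
`WeierstrassCurve.factorization_conductorNorm_eq_one_of_hasMultiplicativeReductionAtPrime`). [cite: Silverman1994, IV.10.2(b)] -/
theorem dvd_conductorNorm_of_hasMultiplicativeReductionAtPrime (W : WeierstrassCurve ℚ) [W.IsElliptic] (p : ℕ) [Fact p.Prime]
    (h : W.HasMultiplicativeReductionAtPrime p) : p ∣ W.conductorNorm ℤ :=
  Nat.dvd_of_factorization_pos (by rw [WeierstrassCurve.factorization_conductorNorm_eq_one_of_hasMultiplicativeReductionAtPrime W p h]; exact one_ne_zero)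

set_option maxHeartbeats 800000 in
/-- **T-An-2ᴴ ⊢ T-An-2ᵍ.** Hida's UNTWISTED lattice on the chart, with fibres «equivalent as Galois representations into `GL₂(Ω)`»,
`Ω = ℂ_p` (the print shape of [Hida1986] Thm. 2.1 (2.2b)/(2.2c), named fact
`hida1986_castella2020_exists_untwistedGaloisLattice_on_pNewBranchChart`), IMPLIES the assembled fact
`hida1986_castella2020_exists_galoisLattice_on_pNewBranchChart` (fibres in the critical twist, conjugate over `ℚ_p` / `K_t`, in
Weierstrass-remainder form): binders and analytic conjuncts pass through; the Galois clause is
`TelescopeBranchLatticeOfUntwisted.exists_isBranchGaloisLattice_of_chart_of_untwisted_conjOver` at `Ω := ℂ_[p]` (critical twist character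
p770687, descent of conjugacy p769852, Weierstrass remainder p770433; `p ≠ 2` from `2 < p`, `p ∣ N` from multiplicative reduction at `p`).
[cite: Hida1986, Thm. 2.1 (2.2b) (2.2c) (p. 557)] [cite: Howard2007BigHeegner, Def. 2.1.3] -/
theorem galoisLattice_of_untwistedGaloisLattice (h : hida1986_castella2020_exists_untwistedGaloisLattice_on_pNewBranchChart) :
    hida1986_castella2020_exists_galoisLattice_on_pNewBranchChart := by
  intro p _ ι W _ _ K _ _ 𝔭 κ γ _ N _ f hf hN hp hmult hK hodd hdisc hHeeg hsplit h𝔭 hι hκ j hj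
  obtain ⟨A, x, D, hchart, han, π, hU⟩ := h ι W K 𝔭 κ γ hf hN hp hmult hK hodd hdisc hHeeg hsplit h𝔭 hι hκ j hj
  exact ⟨A, x, D, hchart, han, exists_isBranchGaloisLattice_of_chart_of_untwisted_conjOver W (by omega)
    (dvd_conductorNorm_of_hasMultiplicativeReductionAtPrime W p hmult) hchart ℂ_[p] π hU.1 hU.2.1 hU.2.2.1 hU.2.2.2⟩

end Summit.BirchSwinnertonDyer.BirchSwinnertonDyer.Theorems.TelescopeBranchGaloisLatticeOfUntwistedFact

end
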